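import Literature.Algebra.Homology.OrderedCechPairSystem
import Mathlib.Data.Prod.Lex
import HarnessLib

/-!
# The lexicographic system of a pair-system: the Čech system of a PRODUCT COVER indexed by `ι ×ₗ κ` (Stacks 0BEC, 01FG)

Layer `Literature/Algebra/Homology` (constructions + proved lemmas; 0 named facts, no instance, no notation; pure algebra over a
commutative ring `A`).  For finite linearly ordered index sets `ι`, `κ` and a PAIR-SYSTEM of `A`-modules
`P : Finset ι ⥤ Finset κ ⥤ ModuleCat A` (`Algebra/Homology/OrderedCechPairSystem`; the motivating instance is
`(s, t) ↦ Γ(U_s ×_S V_t, 𝓕)` for two open covers `𝓤 = (U_i)_{i ∈ ι}`, `𝓥 = (V_j)_{j ∈ κ}`, `Modules/CechBoxTensorBicomplex.boxSectionsSystem`),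
the PRODUCT COVER `𝔚 = (U_i × V_j)_{(i,j)}` is indexed by `ι × κ`, which the ordered Čech complex
(`Algebra/Homology/OrderedCechSystem.sysComplex`) wants LINEARLY ordered: we take the LEXICOGRAPHIC order `ι ×ₗ κ` (Mathlib `Lex (ι × κ)`).
A finite subset `T ⊆ ι ×ₗ κ` has the two projections `π₁ T ⊆ ι`, `π₂ T ⊆ κ`, and
`⋂_{(i,j) ∈ T} U_i × V_j = U_{π₁T} × V_{π₂T}`, so the Čech system of `𝔚` is

* **`lexSystem P : Finset (ι ×ₗ κ) ⥤ ModuleCat A`, `T ↦ P (π₁ T) (π₂ T)`** (`fstProj`, `sndProj`; restriction along `T ⊆ T'` is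
  `P`'s restriction in both variables; `lexSystem_map_hom`, functoriality from the bifunctoriality of `P`);
* `lexSystemMap φ : lexSystem P ⟶ lexSystem P'` — functoriality in the pair-system (`φ : P ⟶ P'`; `lexSystemMap_id/_comp`), the
  currency of the lexicographic comparison `Algebra/Homology/OrderedCechPairSystemLexComparison` (F0P1b-p06);
* `lexSystem_prodSystem_obj` — for the product pair-system `M ⊠ N` (`prodSystem`): `(lexSystem (M ⊠ N)) T = M (π₁T) ⊗ N (π₂T)` and its
  restriction maps are `M.map _ ⊗ N.map _` (`lexSystem_prodSystem_map_tmul`);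
* the elementary combinatorics of the projections used by the cross product and the shuffle map (sequels
  `Algebra/Homology/OrderedCechPairSystem{Cross,Shuffle}`): monotonicity, `card_fstProj_le` / `card_sndProj_le` (`#πᵢT ≤ #T`),
  `fstProj_nonempty_iff`, `mem_product_of_mem` (`T ⊆ π₁T ×ˢ π₂T`), `card_le_card_fstProj_mul_card_sndProj`, and `fst_le_of_le`
  (the FIRST projection is monotone along the lexicographic order — the second is not, which is why the cross product needs the
  alternating evaluation of `Algebra/Homology/OrderedCechSystemAlternating`).

Cell `hodgecm-mathlib` (D-0151), F-11 / J3 Künneth packet, brick (K2-a) of F0P1b-p04's plan (cell bus 2026-08-30T22:08:52Z); consumers (K2-b)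
`cross`, (K2-c) `shuffle`.  HC_CM is proved only modulo the 7 printed citations until rung 0 closes — nothing here bears on a summit statement.

## References
* The Stacks Project, Tag 0BEC (Künneth formula: the Čech complex of the product covering), Tag 01FG (ordered Čech complex). [StacksProject]
* U. Görtz, T. Wedhorn, *Algebraic Geometry II* (2023), Def. 21.64, Def. 21.68 (pp. 179–180). [GortzWedhorn2023]
* S. Eilenberg, S. Mac Lane, *On the groups `H(Π,n)`, I*, Ann. of Math. 58 (1953), §5 (products of complexes, shuffles). [EilenbergMacLane1953]
-/

universe u

open CategoryTheory MonoidalCategory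

set_option backward.isDefEq.respectTransparency false

noncomputable section

namespace Literature.Algebra.Homology

namespace OrderedCech

variable {A : Type u} [CommRing A] {ι κ : Type} [LinearOrder ι] [LinearOrder κ]

/-! ### §1 The two projections of a finite subset of `ι ×ₗ κ` -/

/-- `π₁ T ⊆ ι`: the first projection of `T ⊆ ι ×ₗ κ`. [cite: StacksProject, Tag 0BEC] -/
def fstProj (T : Finset (ι ×ₗ κ)) : Finset ι := T.image fun w => (ofLex w).1

/-- `π₂ T ⊆ κ`: the second projection of `T ⊆ ι ×ₗ κ`. [cite: StacksProject, Tag 0BEC] -/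
def sndProj (T : Finset (ι ×ₗ κ)) : Finset κ := T.image fun w => (ofLex w).2

omit [LinearOrder κ] in
/-- Membership in `π₁ T`. [cite: StacksProject, Tag 0BEC] -/
theorem mem_fstProj {T : Finset (ι ×ₗ κ)} {i : ι} : i ∈ fstProj T ↔ ∃ w ∈ T, (ofLex w).1 = i := Finset.mem_image

omit [LinearOrder ι] in
/-- Membership in `π₂ T`. [cite: StacksProject, Tag 0BEC] -/
theorem mem_sndProj {T : Finset (ι ×ₗ κ)} {j : κ} : j ∈ sndProj T ↔ ∃ w ∈ T, (ofLex w).2 = j := Finset.mem_image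

omit [LinearOrder κ] in
/-- `(i, j) ∈ T ⇒ i ∈ π₁ T`. [cite: StacksProject, Tag 0BEC] -/
theorem fst_mem_fstProj {T : Finset (ι ×ₗ κ)} {w : ι ×ₗ κ} (hw : w ∈ T) : (ofLex w).1 ∈ fstProj T :=
  Finset.mem_image_of_mem _ hw

omit [LinearOrder ι] in
/-- `(i, j) ∈ T ⇒ j ∈ π₂ T`. [cite: StacksProject, Tag 0BEC] -/
theorem snd_mem_sndProj {T : Finset (ι ×ₗ κ)} {w : ι ×ₗ κ} (hw : w ∈ T) : (ofLex w).2 ∈ sndProj T :=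
  Finset.mem_image_of_mem _ hw

omit [LinearOrder κ] in
/-- `π₁` is monotone. [cite: StacksProject, Tag 0BEC] -/
theorem fstProj_mono {T T' : Finset (ι ×ₗ κ)} (h : T ⊆ T') : fstProj T ⊆ fstProj T' := Finset.image_subset_image h

omit [LinearOrder ι] in
/-- `π₂` is monotone. [cite: StacksProject, Tag 0BEC] -/
theorem sndProj_mono {T T' : Finset (ι ×ₗ κ)} (h : T ⊆ T') : sndProj T ⊆ sndProj T' := Finset.image_subset_image h

omit [LinearOrder κ] in
/-- `#π₁T ≤ #T`. [cite: StacksProject, Tag 0BEC] -/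
theorem card_fstProj_le (T : Finset (ι ×ₗ κ)) : (fstProj T).card ≤ T.card := Finset.card_image_le

omit [LinearOrder ι] in
/-- `#π₂T ≤ #T`. [cite: StacksProject, Tag 0BEC] -/
theorem card_sndProj_le (T : Finset (ι ×ₗ κ)) : (sndProj T).card ≤ T.card := Finset.card_image_le

omit [LinearOrder κ] in
/-- `π₁ T ≠ ∅ ↔ T ≠ ∅`. [cite: StacksProject, Tag 0BEC] -/
theorem fstProj_nonempty_iff {T : Finset (ι ×ₗ κ)} : (fstProj T).Nonempty ↔ T.Nonempty := Finset.image_nonempty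

omit [LinearOrder ι] in
/-- `π₂ T ≠ ∅ ↔ T ≠ ∅`. [cite: StacksProject, Tag 0BEC] -/
theorem sndProj_nonempty_iff {T : Finset (ι ×ₗ κ)} : (sndProj T).Nonempty ↔ T.Nonempty := Finset.image_nonempty

omit [LinearOrder κ] in
/-- `π₁ ∅ = ∅`. [cite: StacksProject, Tag 0BEC] -/
@[simp] theorem fstProj_empty : fstProj (∅ : Finset (ι ×ₗ κ)) = ∅ := Finset.image_empty _

omit [LinearOrder ι] in
/-- `π₂ ∅ = ∅`. [cite: StacksProject, Tag 0BEC] -/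
@[simp] theorem sndProj_empty : sndProj (∅ : Finset (ι ×ₗ κ)) = ∅ := Finset.image_empty _

/-- `T ⊆ π₁T ×ˢ π₂T` (read back in `ι ×ₗ κ`). [cite: StacksProject, Tag 0BEC] -/
theorem mem_product_of_mem {T : Finset (ι ×ₗ κ)} {w : ι ×ₗ κ} (hw : w ∈ T) :
    ofLex w ∈ fstProj T ×ˢ sndProj T :=
  Finset.mem_product.mpr ⟨fst_mem_fstProj hw, snd_mem_sndProj hw⟩

/-- `#T ≤ #π₁T · #π₂T`. [cite: StacksProject, Tag 0BEC] -/
theorem card_le_card_fstProj_mul_card_sndProj (T : Finset (ι ×ₗ κ)) :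
    T.card ≤ (fstProj T).card * (sndProj T).card := by
  rw [← Finset.card_product]
  refine Finset.card_le_card_of_injOn (fun w => ofLex w) (fun w hw => mem_product_of_mem hw) ?_
  intro w _ w' _ h
  exact ofLex.injective h

omit [LinearOrder κ] in
/-- `π₁` of a singleton. [cite: StacksProject, Tag 0BEC] -/
@[simp] theorem fstProj_singleton (w : ι ×ₗ κ) : fstProj ({w} : Finset (ι ×ₗ κ)) = {(ofLex w).1} := Finset.image_singleton _ _

omit [LinearOrder ι] in
/-- `π₂` of a singleton. [cite: StacksProject, Tag 0BEC] -/
@[simp] theorem sndProj_singleton (w : ι ×ₗ κ) : sndProj ({w} : Finset (ι ×ₗ κ)) = {(ofLex w).2} := Finset.image_singleton _ _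

/-- Along the lexicographic order the FIRST projection is monotone: `w ≤ w' ⇒ w.1 ≤ w'.1`. [cite: StacksProject, Tag 0BEC] -/
theorem fst_le_of_le {w w' : ι ×ₗ κ} (h : w ≤ w') : (ofLex w).1 ≤ (ofLex w').1 := by
  rcases (Prod.Lex.le_iff (x := ofLex w) (y := ofLex w')).1 h with h1 | ⟨h1, -⟩
  · exact h1.le
  · exact h1.le

/-! ### §2 The lexicographic system `T ↦ P (π₁T) (π₂T)` -/

variable (P : Finset ι ⥤ Finset κ ⥤ ModuleCat.{u} A)

/-- **The lexicographic system of a pair-system**: `T ↦ P (π₁ T) (π₂ T)` on `Finset (ι ×ₗ κ)`, restriction along `T ⊆ T'` being `P`'s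
restriction in both variables (first in `s`, then in `t`).  For `P = (s, t) ↦ Γ(U_s × V_t, 𝓕)` this is the Čech system of the
product cover `(U_i × V_j)_{(i,j) ∈ ι ×ₗ κ}`. [cite: StacksProject, Tag 0BEC] [cite: GortzWedhorn2023, Def. 21.64 (p. 179)] -/
def lexSystem : Finset (ι ×ₗ κ) ⥤ ModuleCat.{u} A where
  obj T := (P.obj (fstProj T)).obj (sndProj T)
  map {T T'} h := (P.map (homOfLE (fstProj_mono h.le))).app (sndProj T) ≫ (P.obj (fstProj T')).map (homOfLE (sndProj_mono h.le))
  map_id T := by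
    have h1 : (homOfLE (fstProj_mono (le_refl T))) = 𝟙 (fstProj T) := rfl
    have h2 : (homOfLE (sndProj_mono (le_refl T))) = 𝟙 (sndProj T) := rfl
    rw [h1, h2, P.map_id, (P.obj (fstProj T)).map_id, NatTrans.id_app, Category.id_comp]
  map_comp {T T' T''} f g := by
    have h1 : (homOfLE (fstProj_mono (f ≫ g).le)) = homOfLE (fstProj_mono f.le) ≫ homOfLE (fstProj_mono g.le) := rfl
    have h2 : (homOfLE (sndProj_mono (f ≫ g).le)) = homOfLE (sndProj_mono f.le) ≫ homOfLE (sndProj_mono g.le) := rfl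
    rw [h1, h2, P.map_comp, NatTrans.comp_app, Functor.map_comp, Category.assoc, Category.assoc]
    congr 1
    rw [← Category.assoc, ← NatTrans.naturality, Category.assoc]

/-- The objects of `lexSystem` (`rfl`). [cite: StacksProject, Tag 0BEC] -/
@[simp] theorem lexSystem_obj (T : Finset (ι ×ₗ κ)) : (lexSystem P).obj T = (P.obj (fstProj T)).obj (sndProj T) := rfl

/-- The maps of `lexSystem`: restrict in `s`, then in `t` (`rfl`). [cite: StacksProject, Tag 0BEC] -/
theorem lexSystem_map {T T' : Finset (ι ×ₗ κ)} (h : T ⟶ T') :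
    (lexSystem P).map h =
      (P.map (homOfLE (fstProj_mono h.le))).app (sndProj T) ≫ (P.obj (fstProj T')).map (homOfLE (sndProj_mono h.le)) := rfl

/-- The maps of `lexSystem`, the other way round: restrict in `t`, then in `s` (bifunctoriality of `P`). [cite: StacksProject, Tag 0BEC] -/
theorem lexSystem_map' {T T' : Finset (ι ×ₗ κ)} (h : T ⟶ T') :
    (lexSystem P).map h =
      (P.obj (fstProj T)).map (homOfLE (sndProj_mono h.le)) ≫ (P.map (homOfLE (fstProj_mono h.le))).app (sndProj T') := by
  rw [lexSystem_map, NatTrans.naturality]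

/-- The maps of `lexSystem` on elements. [cite: StacksProject, Tag 0BEC] -/
theorem lexSystem_map_apply {T T' : Finset (ι ×ₗ κ)} (h : T ⟶ T') (x : (P.obj (fstProj T)).obj (sndProj T)) :
    ((lexSystem P).map h).hom x =
      ((P.obj (fstProj T')).map (homOfLE (sndProj_mono h.le))).hom
        (((P.map (homOfLE (fstProj_mono h.le))).app (sndProj T)).hom x) := rfl

/-! ### §3 The product pair-system: `lexSystem (M ⊠ N) T = M (π₁T) ⊗ N (π₂T)` -/

section Prod

variable (M : Finset ι ⥤ ModuleCat.{u} A) (N : Finset κ ⥤ ModuleCat.{u} A)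

/-- For the product pair-system, `(lexSystem (M ⊠ N)) T = M (π₁ T) ⊗ N (π₂ T)` (`rfl`). [cite: StacksProject, Tag 0BEC] -/
@[simp] theorem lexSystem_prodSystem_obj (T : Finset (ι ×ₗ κ)) :
    (lexSystem (prodSystem M N)).obj T = (M.obj (fstProj T) ⊗ N.obj (sndProj T)) := rfl

/-- The restriction maps of `lexSystem (M ⊠ N)` on pure tensors: `m ⊗ n ↦ M.map _ m ⊗ N.map _ n`. [cite: StacksProject, Tag 0BEC] -/
theorem lexSystem_prodSystem_map_tmul {T T' : Finset (ι ×ₗ κ)} (h : T ⟶ T') (m : M.obj (fstProj T)) (n : N.obj (sndProj T)) :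
    ((lexSystem (prodSystem M N)).map h).hom (m ⊗ₜ[A] n) =
      (M.map (homOfLE (fstProj_mono h.le))).hom m ⊗ₜ[A] (N.map (homOfLE (sndProj_mono h.le))).hom n := by
  rw [lexSystem_map_apply]
  change ((M.obj (fstProj T')) ◁ N.map (homOfLE (sndProj_mono h.le))).hom
      ((M.map (homOfLE (fstProj_mono h.le)) ▷ N.obj (sndProj T)).hom (m ⊗ₜ[A] n)) = _
  rw [ModuleCat.MonoidalCategory.whiskerRight_apply, ModuleCat.MonoidalCategory.whiskerLeft_apply]

end Prod

/-! ### §4 Functoriality in the pair-system -/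

section Map

variable {P} {P' P'' : Finset ι ⥤ Finset κ ⥤ ModuleCat.{u} A}

/-- **Functoriality of `lexSystem` in the pair-system**: a morphism of pair-systems `φ : P ⟶ P'` induces
`lexSystem P ⟶ lexSystem P'`, componentwise `φ (π₁T) (π₂T)` (naturality from the naturality of `φ` in both variables).
[cite: StacksProject, Tag 0BEC] -/
def lexSystemMap (φ : P ⟶ P') : lexSystem P ⟶ lexSystem P' where
  app T := (φ.app (fstProj T)).app (sndProj T)
  naturality {T T'} h := by
    have h1 := NatTrans.congr_app (φ.naturality (homOfLE (fstProj_mono h.le))) (sndProj T)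
    simp only [NatTrans.comp_app] at h1
    rw [lexSystem_map, lexSystem_map, Category.assoc, NatTrans.naturality, ← Category.assoc, h1, Category.assoc]

/-- The components of `lexSystemMap` (`rfl`). [cite: StacksProject, Tag 0BEC] -/
@[simp] theorem lexSystemMap_app (φ : P ⟶ P') (T : Finset (ι ×ₗ κ)) :
    (lexSystemMap φ).app T = (φ.app (fstProj T)).app (sndProj T) := rfl

variable (P) in
/-- `lexSystemMap (𝟙 P) = 𝟙`. [cite: StacksProject, Tag 0BEC] -/
@[simp] theorem lexSystemMap_id : lexSystemMap (𝟙 P) = 𝟙 (lexSystem P) := by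
  ext T : 2
  rfl

/-- `lexSystemMap (φ ≫ ψ) = lexSystemMap φ ≫ lexSystemMap ψ`. [cite: StacksProject, Tag 0BEC] -/
@[simp] theorem lexSystemMap_comp (φ : P ⟶ P') (ψ : P' ⟶ P'') :
    lexSystemMap (φ ≫ ψ) = lexSystemMap φ ≫ lexSystemMap ψ := by
  ext T : 2
  rfl

end Map

end OrderedCech

end Literature.Algebra.Homology

end
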